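/-
Copyright: statement-level skeleton of a published paper (lit-balaban cell, Phase-2 proof seat p25, gen 18). No proof
claims beyond what the kernel checks below.
-/
import Literature.MathematicalPhysics.QuantumFieldTheory.BalabanImbrieJaffe1984to88.BIJ88WalkGeometry311

/-!
# `BalabanImbrieJaffe1984to88.BIJ88WalkLocalCount312` — T. Bałaban, J. Imbrie, A. Jaffe, *Effective action and cluster
properties of the abelian Higgs model*, Commun. Math. Phys. **114** (1988) 257–315 [BalabanImbrieJaffe1988], §5.14
p. 310–312 [PDF 54–56], verbatim: *"We give random walk expansions for the propagators … The leading terms … we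
transform further. The others, localized in region X, have a factor of e^{−cr(e_k)|X|}"*, *"It is now a standard
exercise to estimate the expansion"* — **THE LOCAL COUNT OF THE NONDEGENERATE TERMS** (p25 gen 18): the terms of the
integration by parts with the covariance split `C = Σ_p C_p` that can be non-zero are those in which every piece `p`
SEES the leg `u` it acts on (`C_p u ≠ 0`) and every vertex pulled down is COUPLED to it (`⟨C_p u, leg⟩ ≠ 0`); so the
alternatives at a step are summed with piece weights `ρ ≥ 0` over the pieces seeing the current leg only
(`Σ_{p : C_p u ≠ 0} ρ p ≤ ρ₀` for every admissible direction `u` — for the printed split: `C_loc`, plus the random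
walks STARTING at the cube of `u`, summable by their factors `θ^{|ω|}`), and the vertices count only through the
number `N₀` of (vertex, leg) pairs coupled to `C_p u`: along a run,
`Σ_{o nondegenerate} (Π_{p ∈ o.dp} ρ p)·W^{rpot o} ≤ W^{rpot g}` as soon as `ρ₀·(rpot g + N₀) ≤ W`, `W ≥ 1`
(`run_lsum_le`) — a bound that does not see the number of pieces nor the number of vertices of the interaction
(the volume), only the FIXED family of observables through `rpot`.

statement-level skeleton of published theorems with citation tags; proofs where landed; nothing here is a claim
about the Yang–Mills mass gap

PDF held: `paper:balaban1988-cmp114-bij-abelian-higgs-effective-action` (journal page = PDF page + 256); p. 310–312 =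
PDF 54–56 (`p0054.txt` L24–31, `p0055.txt` L23–38, `p0056.txt` L1–25 re-read this session, 2026-08-22).

CITATION HEADER (lean-in-tree rule).  lit-balaban cell (HOME `run/shared/lean/pub/lit-balaban/`), Phase 2, seat p25
gen 18; row **C2.Claim@312** of `HOME/lit-balaban-r16/ROWS-C2-part2.md` (owner r16, referee ref-5; head
`BIJ88Sect5StatementsPart4.Ineq312` untouched).  USED BY NAME, nothing restated: `BIJ88WalkRun311.{run, rpot, pristine,
WGrp, WOut, WOut.scale/push/bump, rpot_*, run_of_complete, run_of_not_complete}`, `BIJ88WalkGeometry311.Nondeg`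
(this seat and generation), `BIJ88LabelledRun311.{sum_map_bind, sum_map_fbind, sum_map_mbind}` (p25 gen 16),
`BIJ88VertexComponents311.maxArity`.

## What is proved (0 `sorry`, standard axioms, no new `Prop` facts; one definition with body: `nds`)

* §1 `nds` (the weighted indicator of a nondegenerate outcome `[o nondegenerate]·(Π_{p∈o.dp} ρ p)·W^{rpot o}`),
  `nds_nonneg`, `nds_scale_le`, `nds_scale_zero`, `nds_push_le`, `nds_push_zero`, `nds_bump` (how the three
  bookkeeping operations act on it: a zero bracket or a zero direction kills the outcome).
* §2 **`run_lsum_le`** (THE LOCAL WEIGHTED COUNT ALONG A RUN), `run_lsum_pristine_le` (from a pristine observable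
  `i` in the environment `B`: `Σ_{o nondegenerate} Π_{p ∈ o.dp} ρ p ≤ W^{|obs i| + 1 + M·maxArity + Σ_{j∈B}|obs j|}`).
HONEST SCOPE: (a) the locality is HYPOTHESISED in the abstract form `Σ_{p : C_p u ≠ 0} ρ p ≤ ρ₀`,
`#{(m,j) : ⟨C_p u, (legs m)_j⟩ ≠ 0} ≤ N₀` (for print's split these are the finite-range of `C_loc`, the walks
starting at one cube, and the bounded number of vertices of `V` within the range of one piece — not derived here);
(b) the count is along ONE run (the expansion-level telescoping is `BIJ88WalkTermCount312.expand_wsum_le`'s, global);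
(c) no analytic factor; (d) contraction-graph components; (e) no `Ineq312` binder.  NOT summit progress; NOT
continuum; NOT Clay.  Imports `BIJ88WalkGeometry311` only; modifies nothing.
-/

noncomputable section

namespace Literature.MathematicalPhysics.QuantumFieldTheory.BalabanImbrieJaffe1984to88.BIJ88WalkLocalCount312

open Classical Matrix Finset
open scoped BigOperators
open BIJ88VertexComponents311 (maxArity)
open BIJ88LabelledRun311 (fbind mbind sum_map_bind sum_map_fbind sum_map_mbind)
open BIJ88WalkRun311 BIJ88WalkRunEnv311 BIJ88WalkGeometry311

variable {S : Type} [Fintype S] {ι : Type} [Fintype ι] {κ : Type} [LinearOrder κ] {P : Type} [Fintype P]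

/-! ## §1  The weighted indicator of a nondegenerate outcome -/

section Nds

variable (obs : κ → List (S → ℝ)) (M : ℕ) (legs : ι → List (S → ℝ)) (ρ : P → ℝ) (W : ℝ)

/-- **The weighted indicator of a nondegenerate outcome**: `(Π_{p ∈ o.dp} ρ p)·W^{rpot o}` if the outcome has a
non-zero weight and non-zero `χ′`-directions, `0` otherwise (only such outcomes give non-zero terms).
[cite: BalabanImbrieJaffe1988, §5.14 p.311–312] -/
def nds (o : WOut S κ ι P) : ℝ :=
  if Nondeg o then (o.dp.map ρ).prod * W ^ rpot obs M (maxArity legs) o.g o.rest o.done else 0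

variable {obs M legs ρ W}

omit [Fintype S] [LinearOrder κ] [Fintype P] in
/-- Nonnegativity (bookkeeping). [cite: BalabanImbrieJaffe1988, §5.14 p.311] -/
theorem nds_nonneg (hρ : ∀ p, 0 ≤ ρ p) (hW0 : 0 ≤ W) (o : WOut S κ ι P) : 0 ≤ nds obs M legs ρ W o := by
  unfold nds
  split_ifs
  · exact mul_nonneg (Multiset.prod_nonneg fun x hx => by
      obtain ⟨p, -, rfl⟩ := Multiset.mem_map.1 hx; exact hρ p) (pow_nonneg hW0 _)
  · exact le_rfl

omit [Fintype S] [LinearOrder κ] [Fintype P] in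
/-- **A contraction weight recorded**: `nds (o.scale p w) ≤ ρ p · nds o` (equality unless `w = 0`).
[cite: BalabanImbrieJaffe1988, §5.14 p.311] -/
theorem nds_scale_le (hρ : ∀ p, 0 ≤ ρ p) (hW0 : 0 ≤ W) (p : P) (w : ℝ) (o : WOut S κ ι P) :
    nds obs M legs ρ W (o.scale p w) ≤ ρ p * nds obs M legs ρ W o := by
  by_cases h : Nondeg (o.scale p w)
  · have h1 := h.1
    have h2 := h.2
    simp only [WOut.scale_a, WOut.scale_D] at h1 h2
    have ho : Nondeg o := ⟨right_ne_zero_of_mul h1, h2⟩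
    refine le_of_eq ?_
    simp only [nds, if_pos h, if_pos ho, WOut.scale_dp, WOut.scale_g, WOut.scale_rest, WOut.scale_done,
      Multiset.map_cons, Multiset.prod_cons, mul_assoc]
  · rw [nds, if_neg h]
    exact mul_nonneg (hρ p) (nds_nonneg hρ hW0 o)

omit [Fintype S] [LinearOrder κ] [Fintype P] in
/-- **A zero bracket kills the outcome**: `nds (o.scale p 0) = 0`. [cite: BalabanImbrieJaffe1988, §5.14 p.311] -/
theorem nds_scale_zero (p : P) (o : WOut S κ ι P) : nds obs M legs ρ W (o.scale p 0) = 0 := by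
  rw [nds, if_neg]
  intro h
  exact h.1 (by simp)

omit [Fintype S] [LinearOrder κ] [Fintype P] in
/-- **A `χ′`-direction recorded**: `nds (o.push p z) ≤ ρ p · nds o` (equality unless `z = 0`).
[cite: BalabanImbrieJaffe1988, §5.14 p.311] -/
theorem nds_push_le (hρ : ∀ p, 0 ≤ ρ p) (hW0 : 0 ≤ W) (p : P) (z : S → ℝ) (o : WOut S κ ι P) :
    nds obs M legs ρ W (o.push p z) ≤ ρ p * nds obs M legs ρ W o := by
  by_cases h : Nondeg (o.push p z)
  · have h1 := h.1
    have h2 := h.2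
    simp only [WOut.push_a, WOut.push_D] at h1 h2
    have ho : Nondeg o := ⟨h1, fun z' hz' => h2 z' (List.mem_cons_of_mem _ hz')⟩
    refine le_of_eq ?_
    simp only [nds, if_pos h, if_pos ho, WOut.push_dp, WOut.push_g, WOut.push_rest, WOut.push_done,
      Multiset.map_cons, Multiset.prod_cons, mul_assoc]
  · rw [nds, if_neg h]
    exact mul_nonneg (hρ p) (nds_nonneg hρ hW0 o)

omit [Fintype S] [LinearOrder κ] [Fintype P] in
/-- **A zero direction kills the outcome**: `nds (o.push p 0) = 0`. [cite: BalabanImbrieJaffe1988, §5.14 p.311] -/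
theorem nds_push_zero (p : P) (o : WOut S κ ι P) : nds obs M legs ρ W (o.push p 0) = 0 := by
  rw [nds, if_neg]
  intro h
  exact h.2 0 (by simp) rfl

omit [Fintype S] [LinearOrder κ] [Fintype P] in
/-- Recording a vertex does not change the indicator (bookkeeping). [cite: BalabanImbrieJaffe1988, §5.14 p.311] -/
@[simp] theorem nds_bump (o : WOut S κ ι P) : nds obs M legs ρ W o.bump = nds obs M legs ρ W o := rfl

end Nds

/-! ## §2  The local weighted count along a run -/

section Run

variable {Cov : P → Matrix S S ℝ} {trig : P → Bool} {f : S → ℝ} {c : ι → ℝ} {legs : ι → List (S → ℝ)}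
  {obs : κ → List (S → ℝ)} {M : ℕ} {ρ : P → ℝ} {Dir : Set (S → ℝ)} {ρ₀ : ℝ} {N₀ : ℕ}

/-- **THE LOCAL WEIGHTED COUNT ALONG A RUN**: observables and vertex legs with directions in `Dir`; piece weights
`ρ ≥ 0` with `Σ_{p : C_p u ≠ 0} ρ p ≤ ρ₀` for every `u ∈ Dir` (only the pieces SEEING the leg); for every piece `p`
and `u ∈ Dir` at most `N₀` (vertex, leg) pairs with `⟨C_p u, leg⟩ ≠ 0` (only the vertices COUPLED to it); `W ≥ 1`
with `ρ₀·(rpot + N₀) ≤ W`.  Then, pending legs in `Dir`,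
`Σ_{o ∈ run g rest done, o nondegenerate} (Π_{p∈o.dp} ρ p)·W^{rpot o} ≤ W^{rpot g}`.
[cite: BalabanImbrieJaffe1988, §5.14 p.311–312] -/
theorem run_lsum_le (hobs : ∀ j, ∀ w ∈ obs j, w ∈ Dir) (hlegs : ∀ m, ∀ w ∈ legs m, w ∈ Dir) (hρ : ∀ p, 0 ≤ ρ p)
    (hρ₀ : ∀ u ∈ Dir, (∑ p ∈ univ.filter (fun p => Cov p *ᵥ u ≠ 0), ρ p) ≤ ρ₀)
    (hN : ∀ p, ∀ u ∈ Dir,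
      (∑ m, ((range (legs m).length).filter fun j => (Cov p *ᵥ u) ⬝ᵥ (legs m).getD j 0 ≠ 0).card) ≤ N₀) :
    ∀ (n : ℕ) (g : WGrp S κ ι P) (rest : Finset κ) (done : Multiset (WGrp S κ ι P)),
      rpot obs M (maxArity legs) g rest done < n → (∀ w ∈ g.pend, w ∈ Dir) → (∀ h ∈ done, ∀ w ∈ h.pend, w ∈ Dir) →
        ∀ W : ℝ, 1 ≤ W → ρ₀ * ((rpot obs M (maxArity legs) g rest done + N₀ : ℕ) : ℝ) ≤ W →
          ((run Cov trig f c legs obs M g rest done).map (nds obs M legs ρ W)).sum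
            ≤ W ^ rpot obs M (maxArity legs) g rest done
  | 0, _, _, _, hn => fun _ _ _ _ _ => absurd hn (Nat.not_lt_zero _)
  | n + 1, g, rest, done, hn => by
    intro hg hd W hW1 hW
    have hn' : rpot obs M (maxArity legs) g rest done ≤ n := Nat.lt_succ_iff.1 hn
    have hR : 1 ≤ rpot obs M (maxArity legs) g rest done := by simp only [rpot]; omega
    have hW0 : 0 ≤ W := zero_le_one.trans hW1
    set R := rpot obs M (maxArity legs) g rest done with hRdef
    by_cases hc : g.complete M = true
    · rw [run_of_complete Cov trig f c legs obs M hc, Multiset.map_singleton, Multiset.sum_singleton, nds]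
      split_ifs
      · simp [hRdef]
      · exact pow_nonneg hW0 _
    · obtain ⟨u, L, hp⟩ := List.exists_cons_of_ne_nil (WGrp.pend_ne_nil_of_not_complete hc)
      have hnv : Multiset.card g.vxs < M := WGrp.nv_lt_of_not_complete hc
      have hu : u ∈ Dir := hg u (by rw [hp]; exact List.mem_cons_self)
      have hL : ∀ w ∈ L, w ∈ Dir := fun w hw => hg w (by rw [hp]; exact List.mem_cons_of_mem _ hw)
      have hρ₀0 : 0 ≤ ρ₀ := (Finset.sum_nonneg fun p _ => hρ p).trans (hρ₀ u hu)
      have hE0 : 0 ≤ W ^ (R - 1) := pow_nonneg hW0 _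
      -- the induction hypothesis, for every state of smaller potential with admissible pending legs
      have IH : ∀ (g' : WGrp S κ ι P) rest' done', rpot obs M (maxArity legs) g' rest' done' < R →
          (∀ w ∈ g'.pend, w ∈ Dir) → (∀ h ∈ done', ∀ w ∈ h.pend, w ∈ Dir) →
            ((run Cov trig f c legs obs M g' rest' done').map (nds obs M legs ρ W)).sum ≤ W ^ (R - 1) :=
        fun g' rest' done' hlt hg' hd' => by
          have hle : rpot obs M (maxArity legs) g' rest' done' + N₀ ≤ R + N₀ := by omega
          have hW' : ρ₀ * ((rpot obs M (maxArity legs) g' rest' done' + N₀ : ℕ) : ℝ) ≤ W :=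
            le_trans (mul_le_mul_of_nonneg_left (Nat.cast_le.2 hle) hρ₀0) hW
          exact (run_lsum_le hobs hlegs hρ hρ₀ hN n g' rest' done' (lt_of_lt_of_le hlt hn') hg' hd' W hW1 hW').trans
            (pow_le_pow_right₀ hW1 (by omega))
      -- one block through the piece `p` with the bracket `w`: at most `ρ p · W^{R-1}`
      have hblk : ∀ (p : P) (w : ℝ) (g' : WGrp S κ ι P) rest' done', rpot obs M (maxArity legs) g' rest' done' < R →
          (∀ x ∈ g'.pend, x ∈ Dir) → (∀ h ∈ done', ∀ x ∈ h.pend, x ∈ Dir) →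
            ((run Cov trig f c legs obs M g' rest' done').map fun o => nds obs M legs ρ W (o.scale p w)).sum
              ≤ ρ p * W ^ (R - 1) :=
        fun p w g' rest' done' hlt hg' hd' =>
          calc ((run Cov trig f c legs obs M g' rest' done').map fun o => nds obs M legs ρ W (o.scale p w)).sum
              ≤ ((run Cov trig f c legs obs M g' rest' done').map fun o => ρ p * nds obs M legs ρ W o).sum :=
                Multiset.sum_map_le_sum_map _ _ fun o _ => nds_scale_le hρ hW0 p w o
            _ = ρ p * ((run Cov trig f c legs obs M g' rest' done').map (nds obs M legs ρ W)).sum := by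
                rw [Multiset.sum_map_mul_left]
            _ ≤ ρ p * W ^ (R - 1) := mul_le_mul_of_nonneg_left (IH g' rest' done' hlt hg' hd') (hρ p)
      have hpsh : ∀ (p : P) (z : S → ℝ) (g' : WGrp S κ ι P) rest' done', rpot obs M (maxArity legs) g' rest' done' < R →
          (∀ x ∈ g'.pend, x ∈ Dir) → (∀ h ∈ done', ∀ x ∈ h.pend, x ∈ Dir) →
            ((run Cov trig f c legs obs M g' rest' done').map fun o => nds obs M legs ρ W (o.push p z)).sum
              ≤ ρ p * W ^ (R - 1) :=
        fun p z g' rest' done' hlt hg' hd' =>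
          calc ((run Cov trig f c legs obs M g' rest' done').map fun o => nds obs M legs ρ W (o.push p z)).sum
              ≤ ((run Cov trig f c legs obs M g' rest' done').map fun o => ρ p * nds obs M legs ρ W o).sum :=
                Multiset.sum_map_le_sum_map _ _ fun o _ => nds_push_le hρ hW0 p z o
            _ = ρ p * ((run Cov trig f c legs obs M g' rest' done').map (nds obs M legs ρ W)).sum := by
                rw [Multiset.sum_map_mul_left]
            _ ≤ ρ p * W ^ (R - 1) := mul_le_mul_of_nonneg_left (IH g' rest' done' hlt hg' hd') (hρ p)
      -- a block through the piece `p` with a ZERO bracket vanishes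
      have hblk0 : ∀ (p : P) (g' : WGrp S κ ι P) rest' done',
          ((run Cov trig f c legs obs M g' rest' done').map fun o => nds obs M legs ρ W (o.scale p 0)).sum = 0 :=
        fun p g' rest' done' => by simp only [nds_scale_zero, Multiset.map_const', Multiset.sum_replicate, smul_zero]
      -- admissibility of the pending legs of the successor states
      have hI1 : ∀ i, ∀ x ∈ L.eraseIdx i, x ∈ Dir := fun i x hx => hL x (List.mem_of_mem_eraseIdx hx)
      have hI2 : ∀ j i, ∀ x ∈ L ++ (obs j).eraseIdx i, x ∈ Dir := fun j i x hx => by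
        rcases List.mem_append.1 hx with hx | hx
        · exact hL x hx
        · exact hobs j x (List.mem_of_mem_eraseIdx hx)
      have hI3 : ∀ h ∈ done, ∀ i p, ∀ x ∈ (WGrp.absorb trig L g h i p).pend, x ∈ Dir := fun h hh i p x hx => by
        rcases List.mem_append.1 hx with hx | hx
        · exact hL x hx
        · exact hd h hh x (List.mem_of_mem_eraseIdx hx)
      have hI3' : ∀ h : WGrp S κ ι P, ∀ h' ∈ done.erase h, ∀ x ∈ h'.pend, x ∈ Dir :=
        fun h h' hh' => hd h' (Multiset.mem_of_mem_erase hh')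
      have hI6 : ∀ m j, ∀ x ∈ L ++ (legs m).eraseIdx j, x ∈ Dir := fun m j x hx => by
        rcases List.mem_append.1 hx with hx | hx
        · exact hL x hx
        · exact hlegs m x (List.mem_of_mem_eraseIdx hx)
      rw [run_of_not_complete Cov trig f c legs obs M hc hp rest done, sum_map_bind]
      refine le_trans (Finset.sum_le_sum (g := fun p =>
        (if Cov p *ᵥ u ≠ 0 then ρ p else 0) * (((R + N₀ : ℕ) : ℝ) * W ^ (R - 1))) fun p _ => ?_) ?_
      · by_cases hpu : Cov p *ᵥ u = 0
        · -- a piece that does not see the leg: every outcome is degenerate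
          have hite : (if Cov p *ᵥ u ≠ 0 then ρ p else 0) = 0 := by rw [if_neg]; exact fun h => h hpu
          rw [hite, zero_mul]
          simp only [Multiset.map_add, Multiset.sum_add, sum_map_bind, sum_map_fbind, sum_map_mbind, Multiset.map_map,
            Function.comp_def, hpu, zero_dotProduct, mul_zero, neg_zero, nds_bump, nds_scale_zero, nds_push_zero,
            Multiset.map_const', Multiset.sum_replicate, smul_zero, Finset.sum_const_zero, add_zero, le_refl]
        · have hpu' : Cov p *ᵥ u ≠ 0 := hpu
          rw [if_pos hpu']
          simp only [Multiset.map_add, Multiset.sum_add, sum_map_bind, sum_map_fbind, sum_map_mbind, Multiset.map_map,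
            Function.comp_def, nds_bump]
          -- the six blocks
          have h1 : ∑ i ∈ range L.length, ((run Cov trig f c legs obs M
                ⟨L.eraseIdx i, g.nchi, g.vxs, g.lab, p ::ₘ g.pcs, g.nw + (trig p).toNat⟩ rest done).map
                fun o => nds obs M legs ρ W (o.scale p ((Cov p *ᵥ u) ⬝ᵥ L.getD i 0))).sum
              ≤ (L.length : ℝ) * (ρ p * W ^ (R - 1)) :=
            (Finset.sum_le_sum fun i _ => hblk p _ _ rest done (rpot_pair obs M _ rest done hp i _ _) (hI1 i) hd).trans
              (by rw [Finset.sum_const, Finset.card_range, nsmul_eq_mul])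
          have h2 : ∑ j ∈ rest.attach, ∑ i ∈ range (obs j).length, ((run Cov trig f c legs obs M
                ⟨L ++ (obs j).eraseIdx i, g.nchi, g.vxs, g.lab ∪ {j.1}, p ::ₘ g.pcs, g.nw + (trig p).toNat⟩
                (rest.erase j) done).map
                fun o => nds obs M legs ρ W (o.scale p ((Cov p *ᵥ u) ⬝ᵥ (obs j).getD i 0))).sum
              ≤ ((∑ j ∈ rest, (obs j).length : ℕ) : ℝ) * (ρ p * W ^ (R - 1)) := by
            calc _ ≤ ∑ j ∈ rest.attach, (((obs j).length : ℕ) : ℝ) * (ρ p * W ^ (R - 1)) :=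
                  Finset.sum_le_sum fun j _ => (Finset.sum_le_sum fun i _ =>
                    hblk p _ _ _ done (rpot_pristine obs M _ rest done hp j.2 i _ _ _) (hI2 j.1 i) hd).trans
                      (by rw [Finset.sum_const, Finset.card_range, nsmul_eq_mul])
              _ = ((∑ j ∈ rest, (obs j).length : ℕ) : ℝ) * (ρ p * W ^ (R - 1)) := by
                  rw [Finset.sum_attach rest (fun j => (((obs j).length : ℕ) : ℝ) * (ρ p * W ^ (R - 1))),
                    ← Finset.sum_mul, Nat.cast_sum]
          have h3 : (done.attach.map fun h => ∑ i ∈ range h.1.pend.length, ((run Cov trig f c legs obs M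
                (WGrp.absorb trig L g h.1 i p) rest (done.erase h.1)).map
                fun o => nds obs M legs ρ W (o.scale p ((Cov p *ᵥ u) ⬝ᵥ h.1.pend.getD i 0))).sum).sum
              ≤ (((done.map fun h => h.pend.length).sum : ℕ) : ℝ) * (ρ p * W ^ (R - 1)) := by
            calc _ ≤ (done.attach.map fun h => ((h.1.pend.length : ℕ) : ℝ) * (ρ p * W ^ (R - 1))).sum :=
                  Multiset.sum_map_le_sum_map _ _ fun h _ => (Finset.sum_le_sum fun i _ =>
                    hblk p _ _ rest _ (rpot_absorb obs M _ rest done trig hp h.2 i p) (hI3 h.1 h.2 i p)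
                      (hI3' h.1)).trans
                      (by rw [Finset.sum_const, Finset.card_range, nsmul_eq_mul])
              _ = (done.map fun h => ((h.pend.length : ℕ) : ℝ) * (ρ p * W ^ (R - 1))).sum :=
                  congrArg Multiset.sum
                    (Multiset.attach_map_val' done (fun h => ((h.pend.length : ℕ) : ℝ) * (ρ p * W ^ (R - 1))))
              _ = (((done.map fun h => h.pend.length).sum : ℕ) : ℝ) * (ρ p * W ^ (R - 1)) := by
                  rw [Multiset.sum_map_mul_right, Nat.cast_multiset_sum, Multiset.map_map]
                  rfl
          have h4 : ((run Cov trig f c legs obs M ⟨L, g.nchi, g.vxs, g.lab, p ::ₘ g.pcs, g.nw + (trig p).toNat⟩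
                rest done).map fun o => nds obs M legs ρ W (o.scale p ((Cov p *ᵥ u) ⬝ᵥ f))).sum
              ≤ ρ p * W ^ (R - 1) := hblk p _ _ rest done (rpot_drop obs M _ rest done hp _ _ _) hL hd
          have h5 : ((run Cov trig f c legs obs M ⟨L, g.nchi + 1, g.vxs, g.lab, p ::ₘ g.pcs, g.nw + (trig p).toNat⟩
                rest done).map fun o => nds obs M legs ρ W (o.push p (Cov p *ᵥ u))).sum
              ≤ ρ p * W ^ (R - 1) := hpsh p _ _ rest done (rpot_drop obs M _ rest done hp _ _ _) hL hd
          -- the vertices: only the (vertex, leg) pairs coupled to `C_p u` contribute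
          have h6 : ∑ m, ∑ j ∈ range (legs m).length, ((run Cov trig f c legs obs M
                ⟨L ++ (legs m).eraseIdx j, g.nchi, m ::ₘ g.vxs, g.lab, p ::ₘ g.pcs, g.nw + (trig p).toNat⟩ rest done).map
                fun o => nds obs M legs ρ W (o.scale p (-(c m * ((Cov p *ᵥ u) ⬝ᵥ (legs m).getD j 0))))).sum
              ≤ (N₀ : ℝ) * (ρ p * W ^ (R - 1)) := by
            have hmj : ∀ m, ∀ j ∈ range (legs m).length, ((run Cov trig f c legs obs M
                ⟨L ++ (legs m).eraseIdx j, g.nchi, m ::ₘ g.vxs, g.lab, p ::ₘ g.pcs, g.nw + (trig p).toNat⟩ rest done).map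
                fun o => nds obs M legs ρ W (o.scale p (-(c m * ((Cov p *ᵥ u) ⬝ᵥ (legs m).getD j 0))))).sum
                  ≤ (if (Cov p *ᵥ u) ⬝ᵥ (legs m).getD j 0 ≠ 0 then 1 else 0) * (ρ p * W ^ (R - 1)) := by
              intro m j _
              by_cases hb : (Cov p *ᵥ u) ⬝ᵥ (legs m).getD j 0 = 0
              · rw [hb, mul_zero, neg_zero, hblk0, if_neg (not_not.2 rfl), zero_mul]
              · rw [if_pos hb, one_mul]
                exact hblk p _ _ rest done (rpot_vertex obs M rest done legs hp hnv m j _ _) (hI6 m j) hd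
            calc _ ≤ ∑ m, ∑ j ∈ range (legs m).length,
                    (if (Cov p *ᵥ u) ⬝ᵥ (legs m).getD j 0 ≠ 0 then 1 else 0) * (ρ p * W ^ (R - 1)) :=
                  Finset.sum_le_sum fun m _ => Finset.sum_le_sum fun j hj => hmj m j hj
              _ = ((∑ m, ((range (legs m).length).filter
                      fun j => (Cov p *ᵥ u) ⬝ᵥ (legs m).getD j 0 ≠ 0).card : ℕ) : ℝ) * (ρ p * W ^ (R - 1)) := by
                  rw [Nat.cast_sum, Finset.sum_mul]
                  refine Finset.sum_congr rfl fun m _ => ?_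
                  rw [← Finset.sum_mul, Finset.sum_boole]
              _ ≤ (N₀ : ℝ) * (ρ p * W ^ (R - 1)) :=
                  mul_le_mul_of_nonneg_right (by exact_mod_cast hN p u hu) (mul_nonneg (hρ p) hE0)
          -- the number of branches is at most `R + N₀`
          have e : R = L.length + 1 + 1 + (M - Multiset.card g.vxs) * maxArity legs
              + ∑ j ∈ rest, (obs j).length + (done.map fun h => h.pend.length).sum := by
            simp only [hRdef, rpot, hp, List.length_cons]
          have hbr : (L.length + (∑ j ∈ rest, (obs j).length) + (done.map fun h => h.pend.length).sum + 1 + 1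
              + N₀ : ℕ) ≤ R + N₀ := by omega
          have hbr' : (((L.length : ℕ) : ℝ) + ((∑ j ∈ rest, (obs j).length : ℕ) : ℝ)
              + (((done.map fun h => h.pend.length).sum : ℕ) : ℝ) + 1 + 1 + (N₀ : ℝ))
              ≤ ((R + N₀ : ℕ) : ℝ) := by exact_mod_cast hbr
          refine (add_le_add (add_le_add (add_le_add (add_le_add (add_le_add h1 h2) h3) h4) h5) h6).trans ?_
          calc _ = ρ p * ((((L.length : ℕ) : ℝ) + ((∑ j ∈ rest, (obs j).length : ℕ) : ℝ)
                + (((done.map fun h => h.pend.length).sum : ℕ) : ℝ) + 1 + 1 + (N₀ : ℝ)) * W ^ (R - 1)) := by ring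
            _ ≤ ρ p * (((R + N₀ : ℕ) : ℝ) * W ^ (R - 1)) :=
                mul_le_mul_of_nonneg_left (mul_le_mul_of_nonneg_right hbr' hE0) (hρ p)
      -- sum over the pieces seeing the leg
      · have hsum : ∑ p, (if Cov p *ᵥ u ≠ 0 then ρ p else 0) ≤ ρ₀ := by
          rw [← Finset.sum_filter]; exact hρ₀ u hu
        calc ∑ p, (if Cov p *ᵥ u ≠ 0 then ρ p else 0) * (((R + N₀ : ℕ) : ℝ) * W ^ (R - 1))
            = (∑ p, (if Cov p *ᵥ u ≠ 0 then ρ p else 0)) * (((R + N₀ : ℕ) : ℝ) * W ^ (R - 1)) := by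
              rw [Finset.sum_mul]
          _ ≤ ρ₀ * (((R + N₀ : ℕ) : ℝ) * W ^ (R - 1)) :=
              mul_le_mul_of_nonneg_right hsum (mul_nonneg (Nat.cast_nonneg _) hE0)
          _ = ρ₀ * ((R + N₀ : ℕ) : ℝ) * W ^ (R - 1) := by ring
          _ ≤ W * W ^ (R - 1) := mul_le_mul_of_nonneg_right hW hE0
          _ = W ^ R := by rw [← pow_succ', Nat.sub_add_cancel hR]

/-- **THE LOCAL COUNT FROM A PRISTINE OBSERVABLE** (the runs building one component `F^L`/`F_rem` of the observable
`i` in the environment `B`, nothing set aside): with `Φ = |obs i| + 1 + M·maxArity + Σ_{j∈B}|obs j|` and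
`ρ₀·(Φ + N₀) ≤ W`, `W ≥ 1`: `Σ_{o nondegenerate} Π_{p ∈ o.dp} ρ p ≤ W^Φ` — uniformly in the number of pieces and of
vertices. [cite: BalabanImbrieJaffe1988, §5.14 p.311–312] -/
theorem run_lsum_pristine_le (hobs : ∀ j, ∀ w ∈ obs j, w ∈ Dir) (hlegs : ∀ m, ∀ w ∈ legs m, w ∈ Dir)
    (hρ : ∀ p, 0 ≤ ρ p) (hρ₀ : ∀ u ∈ Dir, (∑ p ∈ univ.filter (fun p => Cov p *ᵥ u ≠ 0), ρ p) ≤ ρ₀)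
    (hN : ∀ p, ∀ u ∈ Dir,
      (∑ m, ((range (legs m).length).filter fun j => (Cov p *ᵥ u) ⬝ᵥ (legs m).getD j 0 ≠ 0).card) ≤ N₀)
    (i : κ) (B : Finset κ) {W : ℝ} (hW1 : 1 ≤ W)
    (hW : ρ₀ * (((obs i).length + 1 + M * maxArity legs + ∑ j ∈ B, (obs j).length + N₀ : ℕ) : ℝ) ≤ W) :
    ((run Cov trig f c legs obs M (pristine obs i) B 0).map fun o => if Nondeg o then (o.dp.map ρ).prod else 0).sum
      ≤ W ^ ((obs i).length + 1 + M * maxArity legs + ∑ j ∈ B, (obs j).length) := by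
  have hW0 : 0 ≤ W := zero_le_one.trans hW1
  have hR : rpot obs M (maxArity legs) (pristine obs i : WGrp S κ ι P) B 0
      = (obs i).length + 1 + M * maxArity legs + ∑ j ∈ B, (obs j).length := by
    simp [rpot, pristine]
  have h := run_lsum_le (Cov := Cov) (trig := trig) (f := f) (c := c) (ρ := ρ) hobs hlegs hρ hρ₀ hN _
    (pristine obs i) B 0 (Nat.lt_succ_self _) (fun w hw => hobs i w hw)
    (fun h hh => absurd hh (Multiset.notMem_zero _)) W hW1 (by rw [hR]; exact hW)
  rw [hR] at h
  refine le_trans (Multiset.sum_map_le_sum_map _ _ fun o _ => ?_) h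
  unfold nds
  split_ifs with ho
  · exact le_mul_of_one_le_right (Multiset.prod_nonneg fun x hx => by
      obtain ⟨p, -, rfl⟩ := Multiset.mem_map.1 hx; exact hρ p) (one_le_pow₀ hW1)
  · exact le_rfl

end Run

end Literature.MathematicalPhysics.QuantumFieldTheory.BalabanImbrieJaffe1984to88.BIJ88WalkLocalCount312

end
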